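import Mathlib
import Literature.NumberTheory.Transcendental.KZRulesAssociator
import Literature.NumberTheory.Transcendental.KZProductIdeal
import Literature.NumberTheory.Transcendental.KZGaussMultiplicationChain
import Literature.NumberTheory.Transcendental.KZLogCalculusProofs
import Literature.NumberTheory.Transcendental.LindemannWeierstrassProofs
import Summits.KontsevichZagierPeriods.KontsevichZagierPeriods.Theorems.HurwitzMicroSectorsNormalFormPrincipleAngCarriers

/-!
# Stub `stub_lindemannRing` — crux `OffTetraSectorKernel`, line `odd-hyperbolic-ladder` (skeleton v8, lead c6)

CONJECTURE 1 HOLDS ON LINDEMANN'S RING. In the formal period ring `P = FormalRep ⧸ relations` of the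
Kontsevich–Zagier calculus (`KZ.FormalPeriodRing`: `relations` is a two-sided ideal for the Fubini
product, `KZProductIdeal`; `KZ.evalP : P →+* ℝ`), let `R_π` be the subring generated by

* the ALGEBRAIC POINTS `⟦[pt, a]⟧` (`a` real algebraic; `KZ.IntegralRep.unit.constMul a _`), and
* the ARCTANGENT CARRIERS `⟦[(0,1), 1/(1+t²)]⟧` (value `arctan 1 = π/4`).

THEOREM (`stub_lindemannRing`): `∀ x ∈ R_π, evalP x = 0 → x = 0`.

Proof. The points are the image of a ring homomorphism `φ : K →+* P` from the relative algebraic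
closure `K = algebraicClosure ℚ ℝ` (sums: integrand additivity, rule (1b); products: the Fubini
product of two points is a relabelled point, `KZ.toFormalPeriod_of_constMul`; unit: `[pt, 1]`); all
arctangent carriers pinned by the same domain and integrand have ONE class `t` (rule (1b) with a zero
difference). Hence `R_π ≤ range (Polynomial.eval₂RingHom φ t)`: every element is `p(t)` for a
polynomial `p ∈ K[X]`, and `evalP (p(t)) = p(π/4)` (`evalP ∘ φ = algebraMap K ℝ`, `evalP t = π/4`).
If `evalP x = 0` and `p ≠ 0`, then `π/4` is algebraic over `K`, hence over `ℚ`
(`IsAlgebraic.restrictScalars`, `K/ℚ` algebraic), hence so is `π` — contradicting Lindemann's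
theorem, PROVED in the tree (`Literature.NumberTheory.Transcendental.transcendental_pi_holds`,
from the sorry-free Lindemann–Weierstrass file). So `p = 0` and `x = p(t) = 0`.

Corollary (`lindemannRing_inf_ker_le_relations`): on the formal combinations whose class lies in
`R_π`, `ker eval ≤ relations` — Lindemann's ring is a closed sector of the residue of the crux.

References: F. Lindemann, *Über die Zahl π*, Math. Ann. 20 (1882); A. Baker, *Transcendental Number
Theory* (1975), Ch. 1, Thm 1.3; M. Kontsevich, D. Zagier, *Periods* (2001), §1.2, §4.1.
-/

noncomputable section

open Set MeasureTheory
open Literature.NumberTheory.Transcendental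

namespace Summit.KontsevichZagierPeriods.HyperbolicBloch.OffTetraSectorKernel

/-! ## The algebraic points form a subring of `P`, the image of `K = algebraicClosure ℚ ℝ` -/

/-- The class of a point depends on the constant only (proof irrelevance). [folklore] -/
theorem lindemann_pt_congr {a b : ℝ} (ha : IsAlgebraic ℚ a) (hb : IsAlgebraic ℚ b) (h : a = b) :
    KZ.toFormalPeriod (KZ.of (KZ.IntegralRep.unit.constMul a ha)) =
      KZ.toFormalPeriod (KZ.of (KZ.IntegralRep.unit.constMul b hb)) := by
  subst h
  rfl

/-- **`⟦[pt, a + b]⟧ = ⟦[pt, a]⟧ + ⟦[pt, b]⟧`**: integrand additivity over the point (rule (1b)).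
[cite: KontsevichZagier2001, §1.2 rule (1)] -/
theorem lindemann_pt_add {a b : ℝ} (ha : IsAlgebraic ℚ a) (hb : IsAlgebraic ℚ b) :
    KZ.toFormalPeriod (KZ.of (KZ.IntegralRep.unit.constMul (a + b) (ha.add hb))) =
      KZ.toFormalPeriod (KZ.of (KZ.IntegralRep.unit.constMul a ha)) +
        KZ.toFormalPeriod (KZ.of (KZ.IntegralRep.unit.constMul b hb)) := by
  rw [← map_add, KZ.toFormalPeriod_eq_iff, ← sub_sub]
  exact KZ.integrandAddRel_subset_relations
    ⟨0, KZ.IntegralRep.unit.constMul (a + b) (ha.add hb), KZ.IntegralRep.unit.constMul a ha,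
      KZ.IntegralRep.unit.constMul b hb, rfl, rfl, fun x _ => by simp, rfl⟩

/-- **`⟦[pt, a b]⟧ = ⟦[pt, a]⟧ · ⟦[pt, b]⟧`**: the Fubini product of two points is the relabelled
point `[pt, a (b · 1)]` (`KZ.toFormalPeriod_of_constMul`), which agrees with `[pt, (a b) · 1]` on its
domain (rule (1b) with a zero difference). [cite: KontsevichZagier2001, §4.1] -/
theorem lindemann_pt_mul {a b : ℝ} (ha : IsAlgebraic ℚ a) (hb : IsAlgebraic ℚ b) :
    KZ.toFormalPeriod (KZ.of (KZ.IntegralRep.unit.constMul (a * b) (ha.mul hb))) =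
      KZ.toFormalPeriod (KZ.of (KZ.IntegralRep.unit.constMul a ha)) *
        KZ.toFormalPeriod (KZ.of (KZ.IntegralRep.unit.constMul b hb)) := by
  rw [← KZ.toFormalPeriod_of_constMul a ha (KZ.IntegralRep.unit.constMul b hb),
    KZ.toFormalPeriod_eq_iff]
  exact KZ.of_sub_of_mem_relations_of_eqOn rfl fun x _ => by
    simp only [KZ.IntegralRep.integrand_constMul, KZ.IntegralRep.unit_integrand]
    ring

/-- **`⟦[pt, 1]⟧ = 1`** (the scaled unit `[pt, 1 · 1]` agrees with the unit `[pt, 1]`).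
[cite: KontsevichZagier2001, §4.1] -/
theorem lindemann_pt_one :
    KZ.toFormalPeriod (KZ.of (KZ.IntegralRep.unit.constMul 1 isAlgebraic_one)) = 1 := by
  rw [← KZ.toFormalPeriod_of_unit, KZ.toFormalPeriod_eq_iff]
  exact KZ.of_sub_of_mem_relations_of_eqOn rfl fun x _ => by simp

/-- **`⟦[pt, 0]⟧ = 0`** (zero integrand). [cite: KontsevichZagier2001, §1.2 rule (1)] -/
theorem lindemann_pt_zero :
    KZ.toFormalPeriod (KZ.of (KZ.IntegralRep.unit.constMul 0 isAlgebraic_zero)) = 0 :=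
  KZ.toFormalPeriod_eq_zero_iff.mpr (KZ.of_mem_relations_of_eqOn_zero _ fun x _ => by simp)

/-- **`evalP ⟦[pt, a]⟧ = a`** (the point has volume `1`). [cite: KontsevichZagier2001, §4.1] -/
theorem lindemann_evalP_pt {a : ℝ} (ha : IsAlgebraic ℚ a) :
    KZ.evalP (KZ.toFormalPeriod (KZ.of (KZ.IntegralRep.unit.constMul a ha))) = a := by
  rw [KZ.evalP_toFormalPeriod_of, KZ.IntegralRep.value_constMul, KZ.IntegralRep.value_unit, mul_one]

/-! ## The arctangent carrier -/

/-- Two arctangent carriers pinned by the same domain `(0,1)` and the integrand `1/(1+t²)` there have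
the same class (rule (1b) with a zero difference). [cite: KontsevichZagier2001, §1.2 rule (1)] -/
theorem lindemann_arc_class_eq (A A' : KZ.IntegralRep 1)
    (hAd : A.domain = {t | t 0 ∈ Set.Ioo (0:ℝ) 1})
    (hAi : Set.EqOn A.integrand (fun t => 1 / (1 + t 0 ^ 2)) A.domain)
    (hA'd : A'.domain = {t | t 0 ∈ Set.Ioo (0:ℝ) 1})
    (hA'i : Set.EqOn A'.integrand (fun t => 1 / (1 + t 0 ^ 2)) A'.domain) :
    KZ.toFormalPeriod (KZ.of A) = KZ.toFormalPeriod (KZ.of A') := by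
  refine KZ.toFormalPeriod_eq_iff.mpr (KZ.of_sub_of_mem_relations_of_eqOn (hA'd.trans hAd.symm)
    fun x hx => ?_)
  have hx' : x ∈ A'.domain := by rwa [hA'd, ← hAd]
  rw [hAi hx, hA'i hx']

/-- **The arctangent carrier evaluates to `π/4`**: `∫₀¹ dt/(1+t²) = arctan 1 − arctan 0 = π/4`.
[cite: KontsevichZagier2001, §1.1] -/
theorem lindemann_evalP_arc (A : KZ.IntegralRep 1) (hAd : A.domain = {t | t 0 ∈ Set.Ioo (0:ℝ) 1})
    (hAi : Set.EqOn A.integrand (fun t => 1 / (1 + t 0 ^ 2)) A.domain) :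
    KZ.evalP (KZ.toFormalPeriod (KZ.of A)) = Real.pi / 4 := by
  rw [KZ.evalP_toFormalPeriod_of,
    Summit.KontsevichZagierPeriods.HurwitzMicroSectors.NormalFormPrinciple.PiBox.Dlog.value_angA A hAd
      hAi zero_le_one, Real.arctan_one, Real.arctan_zero, sub_zero, one_mul]

/-- An arctangent carrier `[(0,1), 1/(1+t²)]` exists. [cite: KontsevichZagier2001, §1.1] -/
theorem lindemann_exists_arc : ∃ A : KZ.IntegralRep 1, A.domain = {t | t 0 ∈ Set.Ioo (0:ℝ) 1} ∧
    Set.EqOn A.integrand (fun t => 1 / (1 + t 0 ^ 2)) A.domain := by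
  obtain ⟨A, hAd, hAi⟩ :=
    Summit.KontsevichZagierPeriods.HurwitzMicroSectors.NormalFormPrinciple.PiBox.Dlog.exists_angA
      (a := 0) (b := 1) (d := 1) isAlgebraic_zero isAlgebraic_one isAlgebraic_one
  exact ⟨A, hAd, fun x _ => by rw [hAi]⟩

/-! ## Lindemann's ring -/

/-- **STUB `stub_lindemannRing`: CONJECTURE 1 HOLDS ON LINDEMANN'S RING.** On the subring of the
formal period ring `P = FormalRep ⧸ relations` generated by the algebraic points `⟦[pt, a]⟧` (`a` real
algebraic) and the arctangent carriers `⟦[(0,1), 1/(1+t²)]⟧` (value `π/4`), `evalP x = 0 → x = 0`: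
every element is `p(⟦A⟧)` for a polynomial `p` with real-algebraic coefficients (the points form a
subring — the image of `K = algebraicClosure ℚ ℝ` — and the carriers are pairwise equal classes), and
`p(π/4) = 0` forces `p = 0` since `π` is transcendental (Lindemann 1882; tree theorem
`transcendental_pi_holds`). [cite: Lindemann1882] [cite: KontsevichZagier2001, §1.2] -/
theorem stub_lindemannRing :
    ∀ x ∈ Subring.closure
        ({p : KZ.FormalPeriodRing | ∃ (a : ℝ) (ha : IsAlgebraic ℚ a),
            p = KZ.toFormalPeriod (KZ.of (KZ.IntegralRep.unit.constMul a ha))} ∪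
          {p : KZ.FormalPeriodRing | ∃ A : KZ.IntegralRep 1, A.domain = {t | t 0 ∈ Set.Ioo (0:ℝ) 1} ∧
            Set.EqOn A.integrand (fun t => 1 / (1 + t 0 ^ 2)) A.domain ∧ p = KZ.toFormalPeriod (KZ.of A)}),
      KZ.evalP x = 0 → x = 0 := by
  intro x hx hx0
  -- the coefficient field and the point homomorphism
  let K := algebraicClosure ℚ ℝ
  haveI hKalg : Algebra.IsAlgebraic ℚ K := algebraicClosure.isAlgebraic ℚ ℝ
  let φ : K →+* KZ.FormalPeriodRing :=
    { toFun := fun a => KZ.toFormalPeriod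
        (KZ.of (KZ.IntegralRep.unit.constMul (a : ℝ) ((mem_algebraicClosure_iff).mp a.2)))
      map_one' := (lindemann_pt_congr _ isAlgebraic_one (by simp)).trans lindemann_pt_one
      map_mul' := fun a b =>
        (lindemann_pt_congr _ (((mem_algebraicClosure_iff).mp a.2).mul
          ((mem_algebraicClosure_iff).mp b.2)) (by push_cast; rfl)).trans (lindemann_pt_mul _ _)
      map_zero' := (lindemann_pt_congr _ isAlgebraic_zero (by simp)).trans lindemann_pt_zero
      map_add' := fun a b =>
        (lindemann_pt_congr _ (((mem_algebraicClosure_iff).mp a.2).add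
          ((mem_algebraicClosure_iff).mp b.2)) (by push_cast; rfl)).trans (lindemann_pt_add _ _) }
  have hφ : ∀ a : K, KZ.evalP (φ a) = (a : ℝ) := fun a => lindemann_evalP_pt _
  -- one arctangent carrier names the generator `t`
  obtain ⟨A₀, hA₀d, hA₀i⟩ := lindemann_exists_arc
  let t : KZ.FormalPeriodRing := KZ.toFormalPeriod (KZ.of A₀)
  have ht : KZ.evalP t = Real.pi / 4 := lindemann_evalP_arc A₀ hA₀d hA₀i
  -- every generator is a polynomial in `t` with coefficients from `φ`
  have hle : Subring.closure
      ({p : KZ.FormalPeriodRing | ∃ (a : ℝ) (ha : IsAlgebraic ℚ a),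
          p = KZ.toFormalPeriod (KZ.of (KZ.IntegralRep.unit.constMul a ha))} ∪
        {p : KZ.FormalPeriodRing | ∃ A : KZ.IntegralRep 1, A.domain = {t | t 0 ∈ Set.Ioo (0:ℝ) 1} ∧
          Set.EqOn A.integrand (fun t => 1 / (1 + t 0 ^ 2)) A.domain ∧
          p = KZ.toFormalPeriod (KZ.of A)}) ≤ (Polynomial.eval₂RingHom φ t).range := by
    refine (Subring.closure_le).mpr ?_
    rintro q (⟨a, ha, rfl⟩ | ⟨A, hAd, hAi, rfl⟩)
    · refine ⟨Polynomial.C (⟨a, (mem_algebraicClosure_iff).mpr ha⟩ : K), ?_⟩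
      rw [Polynomial.coe_eval₂RingHom, Polynomial.eval₂_C]
      rfl
    · refine ⟨Polynomial.X, ?_⟩
      rw [Polynomial.coe_eval₂RingHom, Polynomial.eval₂_X]
      exact lindemann_arc_class_eq A₀ A hA₀d hA₀i hAd hAi
  obtain ⟨p, hp⟩ := hle hx
  -- evaluate: `evalP (p(t)) = p(π/4)`
  have hcomp : KZ.evalP.comp φ = algebraMap K ℝ := by
    ext a
    rw [RingHom.comp_apply, hφ]
    rfl
  have hev : KZ.evalP x = Polynomial.aeval (Real.pi / 4) p := by
    rw [← hp, Polynomial.coe_eval₂RingHom, Polynomial.hom_eval₂, hcomp, ht, Polynomial.aeval_def]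
  by_cases hp0 : p = 0
  · rw [← hp, hp0, map_zero]
  · exfalso
    have hK : IsAlgebraic K (Real.pi / 4) := ⟨p, hp0, by rw [← hev, hx0]⟩
    have hQ : IsAlgebraic ℚ (Real.pi / 4) := hK.restrictScalars ℚ
    have hpi : IsAlgebraic ℚ Real.pi := by
      have h := hQ.mul (isAlgebraic_nat (R := ℚ) (A := ℝ) 4)
      have e : Real.pi / 4 * (4 : ℕ) = Real.pi := by push_cast; ring
      rwa [e] at h
    exact transcendental_pi_holds hpi

/-- **LINDEMANN'S RING IS A CLOSED SECTOR OF THE RESIDUE**: on the formal combinations whose class lies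
in Lindemann's ring, `ker eval ≤ relations` (`evalP ⟦c⟧ = eval c`, `⟦c⟧ = 0 ↔ c ∈ relations`).
[cite: KontsevichZagier2001, §1.2] -/
theorem lindemannRing_inf_ker_le_relations :
    KZ.eval.ker ⊓ (Subring.closure
        ({p : KZ.FormalPeriodRing | ∃ (a : ℝ) (ha : IsAlgebraic ℚ a),
            p = KZ.toFormalPeriod (KZ.of (KZ.IntegralRep.unit.constMul a ha))} ∪
          {p : KZ.FormalPeriodRing | ∃ A : KZ.IntegralRep 1, A.domain = {t | t 0 ∈ Set.Ioo (0:ℝ) 1} ∧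
            Set.EqOn A.integrand (fun t => 1 / (1 + t 0 ^ 2)) A.domain ∧
            p = KZ.toFormalPeriod (KZ.of A)})).toAddSubgroup.comap
        KZ.toFormalPeriod.toAddMonoidHom ≤ KZ.relations := by
  rintro c ⟨hc, hS⟩
  have hc0 : KZ.eval c = 0 := hc
  have hS' : KZ.toFormalPeriod c ∈ Subring.closure
      ({p : KZ.FormalPeriodRing | ∃ (a : ℝ) (ha : IsAlgebraic ℚ a),
          p = KZ.toFormalPeriod (KZ.of (KZ.IntegralRep.unit.constMul a ha))} ∪
        {p : KZ.FormalPeriodRing | ∃ A : KZ.IntegralRep 1, A.domain = {t | t 0 ∈ Set.Ioo (0:ℝ) 1} ∧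
          Set.EqOn A.integrand (fun t => 1 / (1 + t 0 ^ 2)) A.domain ∧ p = KZ.toFormalPeriod (KZ.of A)}) := hS
  have h0 : KZ.toFormalPeriod c = 0 :=
    stub_lindemannRing _ hS' (by rw [KZ.evalP_toFormalPeriod, hc0])
  exact KZ.toFormalPeriod_eq_zero_iff.mp h0

/-- **EQUAL VALUES ⇒ EQUAL CLASSES across Lindemann's ring**: two elements of the ring with the same
evaluation are equal in `P` (the difference lies in the ring and evaluates to `0`).
[cite: KontsevichZagier2001, §1.2] -/
theorem lindemannRing_eq_of_evalP_eq {x y : KZ.FormalPeriodRing}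
    (hx : x ∈ Subring.closure
        ({p : KZ.FormalPeriodRing | ∃ (a : ℝ) (ha : IsAlgebraic ℚ a),
            p = KZ.toFormalPeriod (KZ.of (KZ.IntegralRep.unit.constMul a ha))} ∪
          {p : KZ.FormalPeriodRing | ∃ A : KZ.IntegralRep 1, A.domain = {t | t 0 ∈ Set.Ioo (0:ℝ) 1} ∧
            Set.EqOn A.integrand (fun t => 1 / (1 + t 0 ^ 2)) A.domain ∧
            p = KZ.toFormalPeriod (KZ.of A)}))
    (hy : y ∈ Subring.closure
        ({p : KZ.FormalPeriodRing | ∃ (a : ℝ) (ha : IsAlgebraic ℚ a),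
            p = KZ.toFormalPeriod (KZ.of (KZ.IntegralRep.unit.constMul a ha))} ∪
          {p : KZ.FormalPeriodRing | ∃ A : KZ.IntegralRep 1, A.domain = {t | t 0 ∈ Set.Ioo (0:ℝ) 1} ∧
            Set.EqOn A.integrand (fun t => 1 / (1 + t 0 ^ 2)) A.domain ∧
            p = KZ.toFormalPeriod (KZ.of A)}))
    (h : KZ.evalP x = KZ.evalP y) : x = y :=
  sub_eq_zero.mp (stub_lindemannRing _ (Subring.sub_mem _ hx hy) (by rw [map_sub, h, sub_self]))

end Summit.KontsevichZagierPeriods.HyperbolicBloch.OffTetraSectorKernel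

end
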